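import Literature.NumberTheory.EllipticCurves.RootNumberTableThree
import HarnessLib

/-!
# Rizzo's Table II, column `v(N)`: the value on each row (bookkeeping on the transcription)

`Proofs` file (theorems only; no definition, no named fact) in topic
`NumberTheory/EllipticCurves`, companion of `RootNumberTableThree` (the transcription `Rizzo.tableII`
of O. G. Rizzo, Compositio Math. 136 (2003), Table II; that file is untouched), fifth file of the
kernel discharge of `WeierstrassCurve.conductorExponent_eq_tableConductorExponentThree` (cell
`b2b-bsdres`, team n1011, ROW T-PAP3).  For each of the 24 printed rows — in the shape in which
Tate's algorithm produces them (`TateAlgorithm.rowDatum_of_minimal`: exact entries as numerals,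
"`≥ k`" entries as an arbitrary `a : WithTop ℤ` with `KellockDokchitser.atLeast a k`, the special
conditions as the value of the corresponding `decide`) — the `v(N)` entry `(Rizzo.tableII …).2.1` is
computed by unfolding the `if`-cascade (pure evaluation; nothing about curves).  Also two
arithmetic remarks used to read the special condition of the rows `(≥4,6,9)` / `(≥5,6,9)`:
`c_{4,e} · 3 ≡ 0 (mod 9)` once `a > e`, and `y ≡ ±4 (mod 9) ↔ y² + 2 ≡ 0 (mod 9)`.

## References

* O. G. Rizzo, *Average root numbers for a nonconstant family of elliptic curves*, Compositio
  Math. 136 (2003) 1–23, Table II (p. 4). [Rizzo2003]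
-/

namespace Literature.NumberTheory.EllipticCurves

namespace Rizzo

open Literature.NumberTheory.DiophantineGeometry (KodairaSymbol)

/-! ### Rows read with exact entries -/

/-- Row `(0,0,0)`: `v(N) = 0`. [cite: Rizzo2003, Table II (p. 4)] -/
theorem condExp_row_0_0_0 (x y z : ℤ) : (tableII 0 0 0 x y z).2.1 = 0 := by
  unfold tableII; dsimp only
  simp (config := { decide := true }) only [ite_true, ite_false, false_and, and_false]

/-- Row `(1,≥3,0)`: `v(N) = 0`. [cite: Rizzo2003, Table II (p. 4)] -/
theorem condExp_row_1_ge3_0 {b : WithTop ℤ} (hb : KellockDokchitser.atLeast b 3 = true)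
    (hb0 : b ≠ 0) (x y z : ℤ) : (tableII 1 b 0 x y z).2.1 = 0 := by
  unfold tableII; dsimp only
  simp (config := { decide := true }) only [ite_true, ite_false, true_and, false_and, and_false,
    and_true, hb, hb0]

/-- Row `(0,0,≥1)`: `v(N) = 1` (multiplicative reduction). [cite: Rizzo2003, Table II (p. 4)] -/
theorem condExp_row_0_0_pos {c : ℤ} (hc : 1 ≤ c) (x y z : ℤ) : (tableII 0 0 c x y z).2.1 = 1 := by
  unfold tableII; dsimp only
  have hc0 : c ≠ 0 := by omega
  simp (config := { decide := true }) only [ite_true, ite_false, false_and, and_false,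
    and_true, hc, hc0]

/-- Row `(≥2,3,3)` WITHOUT the special condition: type II, `v(N) = 3`. [cite: Rizzo2003, Table II (p. 4)] -/
theorem condExp_row_ge2_3_3_of_not_sp {a : WithTop ℤ} (ha : KellockDokchitser.atLeast a 2 = true)
    (x y z : ℤ) (hsp : decide ((y ^ 2 + 2) % 9 = 3 * c4e a x 2 % 9) = false) :
    (tableII a 3 3 x y z).2.1 = 3 := by
  unfold tableII; dsimp only
  simp (config := { decide := true }) only [ite_true, ite_false, false_and, and_false,
    and_true, ha, hsp]

/-- Row `(≥2,3,3)` WITH the special condition: type III, `v(N) = 2`. [cite: Rizzo2003, Table II (p. 4)] -/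
theorem condExp_row_ge2_3_3_of_sp {a : WithTop ℤ} (ha : KellockDokchitser.atLeast a 2 = true)
    (x y z : ℤ) (hsp : decide ((y ^ 2 + 2) % 9 = 3 * c4e a x 2 % 9) = true) :
    (tableII a 3 3 x y z).2.1 = 2 := by
  unfold tableII; dsimp only
  simp (config := { decide := true }) only [ite_true, ite_false, false_and, and_false,
    and_true, ha, hsp]

/-- Row `(2,4,3)`: type II, `v(N) = 3`. [cite: Rizzo2003, Table II (p. 4)] -/
theorem condExp_row_2_4_3 (x y z : ℤ) : (tableII 2 4 3 x y z).2.1 = 3 := by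
  unfold tableII; dsimp only
  simp (config := { decide := true }) only [ite_true, ite_false, true_and, false_and, and_false]

/-- Row `(2,3,4)`: type II, `v(N) = 4`. [cite: Rizzo2003, Table II (p. 4)] -/
theorem condExp_row_2_3_4 (x y z : ℤ) : (tableII 2 3 4 x y z).2.1 = 4 := by
  unfold tableII; dsimp only
  simp (config := { decide := true }) only [ite_true, ite_false, false_and, and_false]

/-- Row `(≥3,4,5)`: type II, `v(N) = 5`. [cite: Rizzo2003, Table II (p. 4)] -/
theorem condExp_row_ge3_4_5 {a : WithTop ℤ} (ha : KellockDokchitser.atLeast a 3 = true)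
    (ha2 : a ≠ 2) (x y z : ℤ) : (tableII a 4 5 x y z).2.1 = 5 := by
  unfold tableII; dsimp only
  simp (config := { decide := true }) only [ite_true, ite_false, false_and, and_false,
    and_true, ha, ha2]

/-- Row `(2,≥5,3)`: type III, `v(N) = 2`. [cite: Rizzo2003, Table II (p. 4)] -/
theorem condExp_row_2_ge5_3 {b : WithTop ℤ} (hb : KellockDokchitser.atLeast b 5 = true)
    (hb3 : b ≠ 3) (hb4 : b ≠ 4) (hb2 : b ≠ 2) (x y z : ℤ) : (tableII 2 b 3 x y z).2.1 = 2 := by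
  unfold tableII; dsimp only
  simp (config := { decide := true }) only [ite_true, ite_false, true_and, false_and, and_false,
    and_true, hb, hb2, hb3, hb4]

/-- Row `(2,3,5)`: type IV, `v(N) = 3`. [cite: Rizzo2003, Table II (p. 4)] -/
theorem condExp_row_2_3_5 (x y z : ℤ) : (tableII 2 3 5 x y z).2.1 = 3 := by
  unfold tableII; dsimp only
  simp (config := { decide := true }) only [ite_true, ite_false, false_and, and_false]

/-- Row `(3,5,6)`: type IV, `v(N) = 4`. [cite: Rizzo2003, Table II (p. 4)] -/
theorem condExp_row_3_5_6 (x y z : ℤ) : (tableII 3 5 6 x y z).2.1 = 4 := by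
  unfold tableII; dsimp only
  simp (config := { decide := true }) only [ite_true, ite_false, false_and, and_false]

/-- Row `(≥4,5,7)`: type IV, `v(N) = 5`. [cite: Rizzo2003, Table II (p. 4)] -/
theorem condExp_row_ge4_5_7 {a : WithTop ℤ} (ha : KellockDokchitser.atLeast a 4 = true)
    (x y z : ℤ) : (tableII a 5 7 x y z).2.1 = 5 := by
  unfold tableII; dsimp only
  simp (config := { decide := true }) only [ite_true, ite_false, false_and, and_false,
    and_true, ha]

/-- Rows `(2,3,≥6)`: types I₀*, Iₙ*, `v(N) = 2`. [cite: Rizzo2003, Table II (p. 4)] -/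
theorem condExp_row_2_3_ge6 {c : ℤ} (hc : 6 ≤ c) (x y z : ℤ) : (tableII 2 3 c x y z).2.1 = 2 := by
  unfold tableII; dsimp only
  have hc3 : c ≠ 3 := by omega
  have hc4 : c ≠ 4 := by omega
  have hc5 : c ≠ 5 := by omega
  simp (config := { decide := true }) only [ite_true, ite_false, true_and, false_and, and_false,
    and_true, hc, hc3, hc4, hc5]

/-- Row `(3,≥6,6)`: type I₀*, `v(N) = 2`. [cite: Rizzo2003, Table II (p. 4)] -/
theorem condExp_row_3_ge6_6 {b : WithTop ℤ} (hb : KellockDokchitser.atLeast b 6 = true)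
    (hb4 : b ≠ 4) (hb5 : b ≠ 5) (x y z : ℤ) : (tableII 3 b 6 x y z).2.1 = 2 := by
  unfold tableII; dsimp only
  simp (config := { decide := true }) only [ite_true, ite_false, false_and, and_false,
    and_true, hb, hb4, hb5]

/-- Row `(≥4,6,9)` WITH the special condition: type III*, `v(N) = 2`. [cite: Rizzo2003, Table II (p. 4)] -/
theorem condExp_row_ge4_6_9_of_sp {a : WithTop ℤ} (ha : KellockDokchitser.atLeast a 4 = true)
    (x y z : ℤ) (hsp : decide ((y ^ 2 + 2) % 9 = 3 * c4e a x 4 % 9) = true) :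
    (tableII a 6 9 x y z).2.1 = 2 := by
  unfold tableII; dsimp only
  simp (config := { decide := true }) only [ite_true, ite_false, true_and, false_and, and_false,
    and_true, ha, hsp]

/-- Row `(4,6,9)` WITHOUT the special condition: type IV*, `v(N) = 3`. [cite: Rizzo2003, Table II (p. 4)] -/
theorem condExp_row_4_6_9_of_not_sp (x y z : ℤ)
    (hsp : decide ((y ^ 2 + 2) % 9 = 3 * c4e 4 x 4 % 9) = false) :
    (tableII 4 6 9 x y z).2.1 = 3 := by
  unfold tableII; dsimp only
  simp (config := { decide := true }) only [ite_true, ite_false, true_and, false_and, and_false,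
    and_true, hsp]

/-- Row `(≥5,6,9)` with the CORRECTED special condition `c₆' ≢ ±4 (9)`: type IV*, `v(N) = 3`.
[cite: Rizzo2003, Table II (p. 4)] [cite: Varillyalvarado2011, Rem. 4.2 (row (≥5,6,9) corrected)] -/
theorem condExp_row_ge5_6_9_of_not_sp {a : WithTop ℤ} (ha : KellockDokchitser.atLeast a 5 = true)
    (ha4 : a ≠ 4) (x y z : ℤ) (hsp : decide ((y ^ 2 + 2) % 9 = 3 * c4e a x 4 % 9) = false)
    (hy : ¬ (y % 9 = 4 ∨ y % 9 = 5)) : (tableII a 6 9 x y z).2.1 = 3 := by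
  unfold tableII; dsimp only
  simp (config := { decide := true }) only [ite_true, ite_false, false_and, and_false,
    and_true, ha, ha4, hsp, hy, not_false_eq_true]

/-- Row `(4,7,9)`: type IV*, `v(N) = 3`. [cite: Rizzo2003, Table II (p. 4)] -/
theorem condExp_row_4_7_9 (x y z : ℤ) : (tableII 4 7 9 x y z).2.1 = 3 := by
  unfold tableII; dsimp only
  simp (config := { decide := true }) only [ite_true, ite_false, true_and, false_and, and_false]

/-- Row `(4,6,10)`: type IV*, `v(N) = 4`. [cite: Rizzo2003, Table II (p. 4)] -/
theorem condExp_row_4_6_10 (x y z : ℤ) : (tableII 4 6 10 x y z).2.1 = 4 := by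
  unfold tableII; dsimp only
  simp (config := { decide := true }) only [ite_true, ite_false, false_and, and_false]

/-- Row `(≥5,7,11)`: type IV*, `v(N) = 5`. [cite: Rizzo2003, Table II (p. 4)] -/
theorem condExp_row_ge5_7_11 {a : WithTop ℤ} (ha : KellockDokchitser.atLeast a 5 = true)
    (ha4 : a ≠ 4) (x y z : ℤ) : (tableII a 7 11 x y z).2.1 = 5 := by
  unfold tableII; dsimp only
  simp (config := { decide := true }) only [ite_true, ite_false, false_and, and_false,
    and_true, ha, ha4]

/-- Row `(4,≥8,9)`: type III*, `v(N) = 2`. [cite: Rizzo2003, Table II (p. 4)] -/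
theorem condExp_row_4_ge8_9 {b : WithTop ℤ} (hb : KellockDokchitser.atLeast b 8 = true)
    (hb6 : b ≠ 6) (hb7 : b ≠ 7) (x y z : ℤ) : (tableII 4 b 9 x y z).2.1 = 2 := by
  unfold tableII; dsimp only
  simp (config := { decide := true }) only [ite_true, ite_false, true_and, false_and, and_false,
    and_true, hb, hb6, hb7]

/-- Row `(4,6,11)`: type II*, `v(N) = 3`. [cite: Rizzo2003, Table II (p. 4)] -/
theorem condExp_row_4_6_11 (x y z : ℤ) : (tableII 4 6 11 x y z).2.1 = 3 := by
  unfold tableII; dsimp only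
  simp (config := { decide := true }) only [ite_true, ite_false, false_and, and_false]

/-- Row ★`(1,2,0)` (reduced triple of a minimal `(5,8,12)`): type II*, `v(N) = 4`.
[cite: Rizzo2003, Table II (p. 4)] -/
theorem condExp_row_1_2_0 (x y z : ℤ) : (tableII 1 2 0 x y z).2.1 = 4 := by
  unfold tableII; dsimp only
  simp (config := { decide := true }) only [ite_true, ite_false, false_and, and_false]

/-- Row ★`(≥2,2,1)` (reduced triple of a minimal `(≥6,8,13)`): type II*, `v(N) = 5`.
[cite: Rizzo2003, Table II (p. 4)] -/
theorem condExp_row_ge2_2_1 {a : WithTop ℤ} (ha : KellockDokchitser.atLeast a 2 = true)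
    (ha0 : a ≠ 0) (ha1 : a ≠ 1) (x y z : ℤ) : (tableII a 2 1 x y z).2.1 = 5 := by
  unfold tableII; dsimp only
  simp (config := { decide := true }) only [ite_true, ite_false, false_and, and_false,
    and_true, ha, ha0, ha1]

/-! ### Arithmetic of the special condition on the rows `(≥4,6,9)` -/

/-- `y ≡ 4` or `5 (mod 9)` implies `y² + 2 ≡ 0 (mod 9)` — the arithmetic of the corrected special
condition `c₆' ≢ ±4 (9)` of row `(≥5,6,9)`. [cite: Rizzo2003, Table II (p. 4), row (≥5,6,9)]
[cite: Varillyalvarado2011, Rem. 4.2 (row (≥5,6,9) corrected)] -/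
theorem sq_add_two_emod_nine_of_emod {y : ℤ} (hy : y % 9 = 4 ∨ y % 9 = 5) :
    (y ^ 2 + 2) % 9 = 0 := by
  have key : ∀ r : ℤ, (y ^ 2 + 2) % 9 = ((y % 9) ^ 2 + 2) % 9 := by
    intro r
    have h := Int.emod_emod_of_dvd y (dvd_refl (9 : ℤ))
    rw [Int.add_emod, pow_two, Int.mul_emod, ← pow_two]
    conv_rhs => rw [Int.add_emod, pow_two, Int.mul_emod, h, ← pow_two]
  rw [key 0]
  rcases hy with h | h <;> rw [h] <;> decide

/-- For `a > e` (or `c₄ = 0`), `3 · c_{4,e} ≡ 0 (mod 9)`: the special condition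
`c₆'² + 2 ≡ 3c_{4,e} (9)` then reads `c₆'² + 2 ≡ 0 (9)`. [cite: Rizzo2003, p. 2 (notation c_{n,e})] -/
theorem three_mul_c4e_emod_nine_eq_zero {a : WithTop ℤ} {e : ℕ} (x : ℤ)
    (ha : ∀ n : ℤ, a = n → (e : ℤ) < n) : 3 * c4e a x e % 9 = 0 := by
  unfold c4e
  cases a with
  | top => simp
  | coe n =>
    have hn : (e : ℤ) < n := ha n rfl
    have h1 : 1 ≤ (n - e).toNat := by
      have : (1 : ℤ) ≤ n - e := by omega
      omega
    obtain ⟨k, hk⟩ := Nat.exists_eq_add_of_le h1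
    show 3 * (x * 3 ^ (n - ↑e).toNat) % 9 = 0
    rw [hk, pow_add, pow_one]
    exact Int.emod_eq_zero_of_dvd ⟨x * 3 ^ k, by ring⟩

end Rizzo

end Literature.NumberTheory.EllipticCurves
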